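import Summits.ValiantsHypothesis.ValiantsHypothesis.Theorems.LacunarySymmetroidMatrixDescartesCensusDoorA34NodeScalar

/-!
# `MatrixDescartes` census — DOOR A at `(3,4)`: the ISOTROPIC SUB-FAMILY (bordered-determinant normal form)

HONEST FRAMING.  Object-search cell `pub-symmetroid`, door-A seat `val-sym-door-p3` (g10); beside the OPEN typed statement
`DoorA34 = PosRootLawAt 3 4 18` (route item `Theses.LacunarySymmetroid.DoorA34`, stmt-ValiantsHypothesis-19980), asserted nowhere.
This file types the SUB-FAMILY of real symmetric `(3,4)` pencils whose four letters share an ISOTROPIC VECTOR — in coordinates,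
`e₃ᵀ S_l e₃ = (S_l)₂₂ = 0` for every letter `l` — and its scalar normal form:

* the isotropic letters `!![a_l, c_l, u_l; c_l, b_l, v_l; u_l, v_l, 0]` (five real rows `a, b, c, u, v : Fin K → ℝ` packed as
  `E : Fin 5 → Fin K → ℝ`; written as matrix literals, no definition) are symmetric (`isSymm_isoLetter`).
* `det_isoLetters_eval`, `det_pencil_isoLetters_eq` — the BORDERED-DETERMINANT IDENTITY, pointwise and as a polynomial identity in
  `ℝ[X]`:  `det (∑ₗ X^(d l) • !![a_l,c_l,u_l; c_l,b_l,v_l; u_l,v_l,0]) = −(A·V² − 2·Cc·U·V + B·U²)`, where `A = ∑ₗ C(a_l) X^(d l)`, … are the five entry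
  `K`-nomials: the determinant of the isotropic pencil is MINUS the `2 × 2` quadratic form `adj [[A, Cc], [Cc, B]]` evaluated at the
  moving vector `(U, V)` — a `(2,K)` symmetric pencil read along a `K`-nomial vector, one step above the `(2,K)` determinant.
* `card_posRoots_isoForm_le_of_posRootLawOn`, `card_posRoots_isoForm_le_of_doorA34` — the ISOTROPIC SUB-DOOR as a CONSEQUENCE of the
  row: `PosRootLawOn 3 4 18 d` (resp. `DoorA34`) gives `Z₊(A·V² − 2·Cc·U·V + B·U²) ≤ 18` for all five `4`-nomials `a, b, c, u, v` on `d`.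

WHY THE CELL RECORDS IT (located, this seat; report HOME/DOOR-A34-P3G10-REPORT.md §2): in node coordinates (…NodePairChart:
`4W²·det = ab(a+b) − u²b − v²a`) the BULK census extremals (the R4 `W`-family seventeens on `(0,4,9,16)`, `(0,5,11,19)`, `(0,6,13,22)`,
`(0,8,14,23)`, `(0,10,22,38)` and the R2 rows `(0,1,4,36…40)`) sit next to the stratum `a = b = 0` (a NON-EDGE LINE of the Cayley
cubic: «two opposite pairs», engine-6 (L1)), where the weighted pair sums of the node nomials vanish.  On that stratum the pencil is an
identically singular `2`-dimensional pencil with a LINEARLY MOVING kernel vector `k = U k₁ + V k₂`, and the first-order unfolding of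
`det` is `κ · kᵀ F₁ k = B·U² + 2·Cc·U·V + A·V²` with `A, B, Cc` arbitrary `K`-nomials — which is, up to sign and the linear involution
`adj` on `Sym₂`, exactly the determinant of an ISOTROPIC pencil (this file).  So the boundary model of the bulk extremals is itself an
honest `13`-parameter sub-family of symmetric `(3,4)` pencils (codimension `2` modulo congruence), and the located «two-opposite-pairs
law» reads: the extremal pencils are nearly congruent to pencils with a COMMON ISOTROPIC VECTOR (measured: `min_{|p|=1} max_l
|pᵀS_lp|/‖S_l‖ ∈ [8·10⁻⁵, 8·10⁻³]` on those rows versus `[0.05, 0.30]` for random pencils; the rail/flag families `(0,2,5,N)`,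
`(0,3,7,N)` are NOT of this type).  The converse direction «`DoorA34` ⟸ isotropic sub-door» is NOT claimed: it is the located
boundary-extremal conjecture, nothing more.

Nothing here bounds `ζ_sym(3,4)`; `DoorA34` stays OPEN; nothing bears on `MatrixDescartes` (stmt-ValiantsHypothesis-18050) or on
`VP ≠ VNP`.  [folklore] The bordered-determinant identity `det [[R, w], [wᵀ, 0]] = −wᵀ adj(R) w`; elementary.
-/

-- `Summit.ValiantsHypothesis.ValiantsHypothesis.…` repeats a component by the D-0017 layout
-- (single-conjunct summit), which the `dupNamespace` linter flags; the name is mandated.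
set_option linter.dupNamespace false

namespace Summit.ValiantsHypothesis.ValiantsHypothesis.Theorems.LacunarySymmetroidMatrixDescartes.Census

open Polynomial Finset
open scoped BigOperators Polynomial Matrix
open Summit.ValiantsHypothesis.ValiantsHypothesis.Theorems.MatrixDescartes.Negative (PosRootLawAt)
open Summit.ValiantsHypothesis.ValiantsHypothesis.Theorems.SymmetroidDescartes (eval_det_pencil)

/-! ## The isotropic letters -/

/-- The ISOTROPIC letters `!![a_l, c_l, u_l; c_l, b_l, v_l; u_l, v_l, 0]` on the data `E : Fin 5 → Fin K → ℝ` (rows `a = E 0`,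
`b = E 1`, `c = E 2`, `u = E 3`, `v = E 4`; `e₃` is a common isotropic vector: the `(2,2)` entry is `0`) are symmetric. [folklore] -/
theorem isSymm_isoLetter {K : ℕ} (E : Fin 5 → Fin K → ℝ) (l : Fin K) :
    (!![E 0 l, E 2 l, E 3 l; E 2 l, E 1 l, E 4 l; E 3 l, E 4 l, 0] : Matrix (Fin 3) (Fin 3) ℝ).IsSymm := by
  unfold Matrix.IsSymm
  ext i j
  fin_cases i <;> fin_cases j <;> rfl

/-! ## The bordered-determinant identity -/

/-- **Bordered determinant, pointwise.**  At every real `t`, the determinant of the isotropic pencil evaluates to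
`−(a(t)·v(t)² − 2·c(t)·u(t)·v(t) + b(t)·u(t)²)` with `a(t) = ∑ₗ a_l t^(d l)`, … the five entry `K`-nomials
(`det [[R, w], [wᵀ, 0]] = −wᵀ adj(R) w` for `R = [[a, c], [c, b]]`, `w = (u, v)`). [folklore] -/
theorem det_isoLetters_eval {K : ℕ} (d : Fin K → ℕ) (E : Fin 5 → Fin K → ℝ) (t : ℝ) :
    ((∑ l, (X : ℝ[X]) ^ d l • (!![E 0 l, E 2 l, E 3 l; E 2 l, E 1 l, E 4 l; E 3 l, E 4 l, 0] : Matrix (Fin 3) (Fin 3) ℝ).map C).det).eval t =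
      -((∑ l, E 0 l * t ^ d l) * (∑ l, E 4 l * t ^ d l) ^ 2
          - 2 * (∑ l, E 2 l * t ^ d l) * (∑ l, E 3 l * t ^ d l) * (∑ l, E 4 l * t ^ d l)
          + (∑ l, E 1 l * t ^ d l) * (∑ l, E 3 l * t ^ d l) ^ 2) := by
  rw [eval_det_pencil]
  have hentry : ∀ i j, (∑ l, t ^ d l • (!![E 0 l, E 2 l, E 3 l; E 2 l, E 1 l, E 4 l; E 3 l, E 4 l, 0] :
      Matrix (Fin 3) (Fin 3) ℝ)) i j = ∑ l, t ^ d l * (!![E 0 l, E 2 l, E 3 l; E 2 l, E 1 l, E 4 l; E 3 l, E 4 l, 0] :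
        Matrix (Fin 3) (Fin 3) ℝ) i j := by
    intro i j
    simp only [Matrix.sum_apply, Matrix.smul_apply, smul_eq_mul]
  rw [Matrix.det_fin_three]
  simp only [hentry]
  simp
  have hcomm : ∀ k : Fin 5, (∑ l, t ^ d l * E k l) = ∑ l, E k l * t ^ d l :=
    fun k => Finset.sum_congr rfl fun l _ => mul_comm _ _
  simp only [hcomm]
  ring

/-- **Bordered determinant, as a POLYNOMIAL identity.**  `det (∑ₗ X^(d l) • !![a_l,c_l,u_l; c_l,b_l,v_l; u_l,v_l,0]) =
−(A·V² − 2·Cc·U·V + B·U²)` in `ℝ[X]`,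
with `A = ∑ₗ C(a_l) X^(d l)`, `B`, `Cc`, `U`, `V` the entry `K`-nomials. [folklore] -/
theorem det_pencil_isoLetters_eq {K : ℕ} (d : Fin K → ℕ) (E : Fin 5 → Fin K → ℝ) :
    (∑ l, (X : ℝ[X]) ^ d l • (!![E 0 l, E 2 l, E 3 l; E 2 l, E 1 l, E 4 l; E 3 l, E 4 l, 0] : Matrix (Fin 3) (Fin 3) ℝ).map C).det =
      -((∑ l, C (E 0 l) * (X : ℝ[X]) ^ d l) * (∑ l, C (E 4 l) * (X : ℝ[X]) ^ d l) ^ 2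
          - 2 * (∑ l, C (E 2 l) * (X : ℝ[X]) ^ d l) * (∑ l, C (E 3 l) * (X : ℝ[X]) ^ d l)
              * (∑ l, C (E 4 l) * (X : ℝ[X]) ^ d l)
          + (∑ l, C (E 1 l) * (X : ℝ[X]) ^ d l) * (∑ l, C (E 3 l) * (X : ℝ[X]) ^ d l) ^ 2) := by
  apply Polynomial.funext
  intro t
  rw [det_isoLetters_eval]
  simp only [eval_neg, eval_add, eval_sub, eval_mul, eval_pow, eval_ofNat, eval_nodePoly]

/-! ## The isotropic sub-door as a consequence of the row -/

/-- **The ISOTROPIC SUB-DOOR on a support follows from the row.**  If `PosRootLawOn 3 4 18 d` holds (every real symmetric `(3,4)`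
pencil on `d` has `≤ 18` distinct positive det-roots), then for all five `4`-nomials `a, b, c, u, v` on `d` the scalar
`A·V² − 2·Cc·U·V + B·U²` has at most `18` distinct positive roots. [folklore] -/
theorem card_posRoots_isoForm_le_of_posRootLawOn (d : Fin 4 → ℕ) (h : PosRootLawOn 3 4 18 d) (E : Fin 5 → Fin 4 → ℝ) :
    ((-((∑ l, C (E 0 l) * (X : ℝ[X]) ^ d l) * (∑ l, C (E 4 l) * (X : ℝ[X]) ^ d l) ^ 2
          - 2 * (∑ l, C (E 2 l) * (X : ℝ[X]) ^ d l) * (∑ l, C (E 3 l) * (X : ℝ[X]) ^ d l)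
              * (∑ l, C (E 4 l) * (X : ℝ[X]) ^ d l)
          + (∑ l, C (E 1 l) * (X : ℝ[X]) ^ d l) * (∑ l, C (E 3 l) * (X : ℝ[X]) ^ d l) ^ 2)).roots.toFinset.filter
        (fun t => 0 < t)).card ≤ 18 := by
  have h' := h (fun l => !![E 0 l, E 2 l, E 3 l; E 2 l, E 1 l, E 4 l; E 3 l, E 4 l, 0]) (fun l => isSymm_isoLetter E l)
  rw [det_pencil_isoLetters_eq] at h'
  exact h'

/-- **`DoorA34` implies the isotropic sub-door on every support.**  (The converse — that the bulk extremals of `ζ_sym(3,4)` are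
governed by this sub-family — is the located boundary-extremal picture of the seat report, NOT a theorem.) [folklore] -/
theorem card_posRoots_isoForm_le_of_doorA34 (h : DoorA34) (d : Fin 4 → ℕ) (E : Fin 5 → Fin 4 → ℝ) :
    ((-((∑ l, C (E 0 l) * (X : ℝ[X]) ^ d l) * (∑ l, C (E 4 l) * (X : ℝ[X]) ^ d l) ^ 2
          - 2 * (∑ l, C (E 2 l) * (X : ℝ[X]) ^ d l) * (∑ l, C (E 3 l) * (X : ℝ[X]) ^ d l)
              * (∑ l, C (E 4 l) * (X : ℝ[X]) ^ d l)
          + (∑ l, C (E 1 l) * (X : ℝ[X]) ^ d l) * (∑ l, C (E 3 l) * (X : ℝ[X]) ^ d l) ^ 2)).roots.toFinset.filter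
        (fun t => 0 < t)).card ≤ 18 :=
  card_posRoots_isoForm_le_of_posRootLawOn d (h d) E

/-- **Roots are those of the quadratic form along the moving vector** (sign does not matter): the det-root multiset of the isotropic
pencil is the root multiset of `A·V² − 2·Cc·U·V + B·U²`. [folklore] -/
theorem roots_det_pencil_isoLetters {K : ℕ} (d : Fin K → ℕ) (E : Fin 5 → Fin K → ℝ) :
    (∑ l, (X : ℝ[X]) ^ d l • (!![E 0 l, E 2 l, E 3 l; E 2 l, E 1 l, E 4 l; E 3 l, E 4 l, 0] : Matrix (Fin 3) (Fin 3) ℝ).map C).det.roots =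
      ((∑ l, C (E 0 l) * (X : ℝ[X]) ^ d l) * (∑ l, C (E 4 l) * (X : ℝ[X]) ^ d l) ^ 2
          - 2 * (∑ l, C (E 2 l) * (X : ℝ[X]) ^ d l) * (∑ l, C (E 3 l) * (X : ℝ[X]) ^ d l)
              * (∑ l, C (E 4 l) * (X : ℝ[X]) ^ d l)
          + (∑ l, C (E 1 l) * (X : ℝ[X]) ^ d l) * (∑ l, C (E 3 l) * (X : ℝ[X]) ^ d l) ^ 2).roots := by
  rw [det_pencil_isoLetters_eq, Polynomial.roots_neg]

end Summit.ValiantsHypothesis.ValiantsHypothesis.Theorems.LacunarySymmetroidMatrixDescartes.Census
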